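import Literature.NumberTheory.GaloisCohomology.PoitouTateRestrictedRamificationNaturalConsequences
import Literature.NumberTheory.GaloisCohomology.PoitouTate
import Literature.NumberTheory.GaloisRepresentations.LocalGlobalCohomologyDualityProofs
import Literature.AlgebraicTopology.SingularHomology.KroneckerInjectiveSelfInjective
import HarnessLib

/-!
# `Ш²_S(K, M) × Ш¹_S(K, M^D) → ℤ/n` is PERFECT from a readout, for a FINITE set `S` of places
# (the `S`-version of the last step of the Poitou–Tate presentation road; Milne I Thm. 4.10 (a))

Theorems only (no definition, no named fact, no `sorry`, no instance, no notation).  Topic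
`NumberTheory/GaloisCohomology`; namespace `Literature.NumberTheory.GaloisCohomology`.  Lane
«PT-Ш-S-TC» of cell `bsd-eis` (crux `GoodLatticeBDPValue`), brick D4c: the `S`-version of the tree's
`…MuRealShaDualAnnihilator.sha_tateDual_of_readout_real` (seat chl-p2 g5 / tp2-p3 g4, all places), for the
groups of `PoitouTateRestrictedRamification.lean`: `Hⁿ(G_S, M^{N_S}) = restrictedCohomology ρ S n`,
`Шⁿ_S(K, M) = shaRestricted ρ S n`, localisation `restrictedLocalization ρ S v n` at the places `v` of
`Σ = S ∪ Ω_∞`.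

THE MATHEMATICS (Milne, *ADT* I Thm. 4.10 (a), proof p. 58, in the form the presentation road delivers
it).  Let `S` be FINITE and `Σ` the finite set of places "`S` and the infinite places" (`Sig` below).  By
definition `Ш¹_S(K, M^D) = {y ∈ H¹(G_S, M^D) : y_v = 0 for all v ∈ Σ}`, so a character
`φ : H¹(G_S, M^D) → ℤ/n` killing `Ш¹_S(K, M^D)` factors through the image of
`y ↦ (y_v)_{v ∈ Σ}` in the FINITE group `⊕_{v ∈ Σ} H¹(K_v, M^D)`, extends to all of it (`ℤ/n` is
self-injective), and is therefore a sum of LOCAL Tate pairings `y ↦ ∑_{v ∈ Σ} inv_v(t_v ∪ y_v)` for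
some family `t_v ∈ H¹(K_v, M)` — by local Tate duality at the finite places of `S`
(`LocalInvariants.IsPerfect`) and an archimedean representability hypothesis at the infinite ones
(`harch`; vacuous for a totally complex `K`, where `H¹(K_w, ·) = 0`, and Milne I Thm. 2.13 (a) in
general) — §1 `exists_family_sum_localTatePairing_eq_of_shaRestricted`.  No «unramified outside a
finite `T`» device and no `SelmerComplement` are needed, unlike at `S =` all places.  Consequently
(§2 **`shaRestricted_tateDual_of_readout`**): a READOUT `e : Ш²_S(K, M) → Hom(H¹(G_S, M^D), ℤ/n)` that
is additive, injective and surjective MODULO `Σ`-LOCAL SUMS (the three displayed hypotheses, which the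
road's degree-`2` obstruction map and (R3)/(R4) produce) restricts to a PERFECT pairing
`b : Ш²_S(K, M) × Ш¹_S(K, M^D) → ℤ/n`, `b c y = e c y`, and `Ш²_S(K, M)` is finite.  The identity
`b c y = e c y` is kept in the conclusion: the lane defines its pairing as ONE function of the module
(D5a) and reads perfectness off this theorem.

Universe: `K M : Type`, as the named facts `poitouTate_shaRestricted_tateDual(_natural)` (the lane's
consumers); the all-places template is universe-polymorphic.

HONEST FRAMING: a reduction with displayed hypotheses; no case of Poitou–Tate duality and nothing about
BSD is proved here.  AI formalisation, weaker than expert review; established only by the kernel check.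

## References
* J. S. Milne, *Arithmetic Duality Theorems*, 2nd ed. (2006), I Thm. 4.10 (a) and its proof (p. 58),
  I Cor. 2.3, I Thm. 2.13 (a), I §0 Prop. 0.19. [MilneADT2006]
* D. Harari, *Galois Cohomology and Class Field Theory* (2020), Thm. 17.13 (b), §17.3. [Harari2020]
* T. Y. Lam, *Lectures on Modules and Rings* (1999), §3B Thm. 3.7, §15 (`ℤ/n` is self-injective). [Lam1999]
-/

noncomputable section

open Function NumberField IsDedekindDomain
open scoped NumberField

namespace Literature.NumberTheory.GaloisCohomology

open Literature.NumberTheory.GaloisRepresentations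
open Literature.NumberTheory.GaloisRepresentations.DiscreteGaloisModule (TateDual tateDual
  restrictedCohomology restrictedLocalization shaRestricted localTatePairingZMod)

/-! ## §0 Characters of a subgroup of an `n`-torsion group extend -/

section Extend

/-- **Characters of a subgroup extend** (`ℤ/n` is self-injective; Baer's criterion): for an abelian
group `A` with `n • A = 0`, a subgroup `B ≤ A` and an additive `χ : B → ℤ/n`, there is an additive
`φ : A → ℤ/n` with `φ|_B = χ`.  (Literature-side copy of the tree's Summits-side
`exists_addMonoidHom_extend_of_nsmul_eq_zero`.) [cite: Lam1999, §15 and §3B Thm. 3.7] -/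
theorem exists_addMonoidHom_extend_of_nsmul_eq_zero' {A : Type*} [AddCommGroup A] {n : ℕ} [NeZero n]
    (hA : ∀ a : A, n • a = 0) (B : AddSubgroup A) (χ : B →+ ZMod n) :
    ∃ φ : A →+ ZMod n, ∀ b : B, φ b = χ b := by
  have hB : ∀ b : B, n • b = 0 := fun b => Subtype.ext (by rw [AddSubgroup.coe_nsmul, hA, AddSubgroup.coe_zero])
  letI : Module (ZMod n) A := AddCommGroup.zmodModule hA
  letI : Module (ZMod n) B := AddCommGroup.zmodModule hB
  obtain ⟨g, hg⟩ := (Literature.AlgebraicTopology.SingularHomology.ZMod.baer_self n).extension_property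
    (B.subtype.toZModLinearMap n) (fun x y h => Subtype.ext h) (χ.toZModLinearMap n)
  refine ⟨g.toAddMonoidHom, fun b => ?_⟩
  have := LinearMap.congr_fun hg b
  simpa using this

end Extend

/-! ## §1 The annihilator of `Ш¹_S(K, M^D)` is the group of `Σ`-local sums (finite `S`) -/

section Annihilator

variable {K : Type} [Field K] [NumberField K] {M : Type} [AddCommGroup M] [TopologicalSpace M]
  [DiscreteTopology M] [Finite M] {n : ℕ} [NeZero n]

/-- **A character of `H¹(G_S, M^D)` killing `Ш¹_S(K, M^D)` is a sum of local Tate pairings over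
`Σ = S ∪ Ω_∞`**, for `S` finite (`Sig` a finite set of places consisting of all the infinite places and
the finite places of `S`): `φ(y) = ∑_{v ∈ Σ} inv_v(t_v ∪ y_v)` for one family `t_v ∈ H¹(K_v, M)`.
Ingredients: `Ш¹_S = ker (y ↦ (y_v)_{v ∈ Σ})`, character extension in the finite `n`-torsion group
`⊕_{v ∈ Σ} H¹(K_v, M^D)`, local Tate duality at the finite `v ∈ S` (`IsPerfect`: the adjoint
`x ↦ inv_v(x ∪ ·)` is onto) and the archimedean representability hypothesis `harch`.
[cite: MilneADT2006, I Thm. 4.10 (a) (proof, p. 58) and I Cor. 2.3] -/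
theorem exists_family_sum_localTatePairing_eq_of_shaRestricted (ρ : DiscreteGaloisModule K M)
    (hM : ∀ m : M, n • m = 0) (S : Set (HeightOneSpectrum (𝓞 K))) (Sig : Finset (Place K))
    (hSig₁ : ∀ w : InfinitePlace K, (Sum.inl w : Place K) ∈ Sig)
    (hSig₂ : ∀ v : HeightOneSpectrum (𝓞 K), (Sum.inr v : Place K) ∈ Sig ↔ v ∈ S)
    {inv : LocalInvariants K n} (hperf : inv.IsPerfect)
    (harch : ∀ (w : InfinitePlace K) (Φ : galoisCohomology ((ρ.tateDual n).toLocal (Sum.inl w)) 1 →+ ZMod n),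
      ∃ t : galoisCohomology (ρ.toLocal (Sum.inl w)) 1,
        ∀ x, Φ x = localTatePairingZMod ρ n (Sum.inl w) (inv (Sum.inl w)) t x)
    (φ : restrictedCohomology (ρ.tateDual n) S 1 →+ ZMod n)
    (hφ : ∀ y ∈ shaRestricted (ρ.tateDual n) S 1, φ y = 0) :
    ∃ t : Π v : Place K, galoisCohomology (ρ.toLocal v) 1,
      ∀ y : restrictedCohomology (ρ.tateDual n) S 1,
        φ y = ∑ v ∈ Sig, localTatePairingZMod ρ n v (inv v) (t v)
          (restrictedLocalization (ρ.tateDual n) S v 1 y) := by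
  classical
  -- the `Σ`-localisation `L : H¹(G_S, M^D) → ⊕_{v ∈ Σ} H¹(K_v, M^D)`
  let P : Type := ∀ v : ↥Sig, galoisCohomology ((ρ.tateDual n).toLocal v.1) 1
  let L : restrictedCohomology (ρ.tateDual n) S 1 →+ P :=
    AddMonoidHom.pi fun v => restrictedLocalization (ρ.tateDual n) S v.1 1
  have hL : ∀ y v, L y v = restrictedLocalization (ρ.tateDual n) S v.1 1 y := fun _ _ => rfl
  -- its kernel is `Ш¹_S(K, M^D)`, on which `φ` vanishes
  have hker : ∀ y, L y = 0 → φ y = 0 := by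
    intro y hy
    refine hφ y ((DiscreteGaloisModule.mem_shaRestricted_iff _ _ _ _).2 ⟨fun w => ?_, fun v hv => ?_⟩)
    · have := congr_fun hy ⟨Sum.inl w, hSig₁ w⟩
      rwa [hL] at this
    · have := congr_fun hy ⟨Sum.inr v, (hSig₂ v).2 hv⟩
      rwa [hL] at this
  -- `φ` factors through the range of `L`
  let ψ : restrictedCohomology (ρ.tateDual n) S 1 ⧸ L.ker →+ ZMod n :=
    QuotientAddGroup.lift L.ker φ fun y hy => hker y hy
  let χ : L.range →+ ZMod n := ψ.comp (QuotientAddGroup.quotientKerEquivRange L).symm.toAddMonoidHom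
  have hχ : ∀ y, χ ⟨L y, ⟨y, rfl⟩⟩ = φ y := by
    intro y
    change ψ ((QuotientAddGroup.quotientKerEquivRange L).symm ⟨L y, ⟨y, rfl⟩⟩) = φ y
    have h : (QuotientAddGroup.quotientKerEquivRange L).symm ⟨L y, ⟨y, rfl⟩⟩ = (y : _ ⧸ L.ker) := by
      apply (QuotientAddGroup.quotientKerEquivRange L).injective
      rw [AddEquiv.apply_symm_apply]
      rfl
    rw [h]
    rfl
  -- `P` is `n`-torsion; extend `χ` to all of `P`
  have hP : ∀ x : P, n • x = 0 := fun x => funext fun v => by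
    rw [Pi.smul_apply, Pi.zero_apply]
    exact galoisCohomology.nsmul_eq_zero_of_forall _
      (fun f => DiscreteGaloisModule.TateDual.nsmul_eq_zero f) _
  obtain ⟨Φ, hΦ⟩ := exists_addMonoidHom_extend_of_nsmul_eq_zero' hP L.range χ
  have hΦL : ∀ y, Φ (L y) = φ y := fun y => by rw [← hχ y, ← hΦ ⟨L y, ⟨y, rfl⟩⟩]
  -- represent each component `Φ ∘ ι_v` by a local class `t_v`
  have hrep : ∀ v : ↥Sig, ∃ t : galoisCohomology (ρ.toLocal v.1) 1,
      ∀ x, Φ (Pi.single v x) = localTatePairingZMod ρ n v.1 (inv v.1) t x := by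
    rintro ⟨v, hv⟩
    rcases v with w | v
    · obtain ⟨t, ht⟩ := harch w (Φ.comp (AddMonoidHom.single (fun u : ↥Sig =>
        galoisCohomology ((ρ.tateDual n).toLocal u.1) 1) ⟨Sum.inl w, hv⟩))
      exact ⟨t, fun x => ht x⟩
    · obtain ⟨t, ht⟩ := ((hperf v).2 ρ hM).1.2 (Φ.comp (AddMonoidHom.single (fun u : ↥Sig =>
        galoisCohomology ((ρ.tateDual n).toLocal u.1) 1) ⟨Sum.inr v, hv⟩))
      exact ⟨t, fun x => (DFunLike.congr_fun ht x).symm⟩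
  choose tt htt using hrep
  refine ⟨fun v => if h : v ∈ Sig then tt ⟨v, h⟩ else 0, fun y => ?_⟩
  -- `φ y = Φ (L y) = ∑_v Φ (ι_v (y_v)) = ∑_v inv_v (t_v ∪ y_v)`
  rw [← hΦL, ← Finset.univ_sum_single (L y), map_sum, ← Finset.sum_coe_sort Sig]
  refine Finset.sum_congr rfl fun v _ => ?_
  rw [htt, hL]
  simp only [dif_pos v.2]

end Annihilator

/-! ## §2 The perfect pairing `Ш²_S(K, M) × Ш¹_S(K, M^D) → ℤ/n` from a readout -/

section Perfect

variable {K : Type} [Field K] [NumberField K] {M : Type} [AddCommGroup M] [TopologicalSpace M]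
  [DiscreteTopology M] [Finite M] {n : ℕ} [NeZero n]

/-- **Milne I Thm. 4.10 (a) for `G_S`, `S` finite, from a readout.**  Let `e : Ш²_S(K, M) →
Hom(H¹(G_S, M^D), ℤ/n)` be additive, injective and surjective MODULO `Σ`-LOCAL SUMS
`y ↦ ∑_{v ∈ Σ} inv_v(t_v ∪ y_v)` (hypotheses `hadd`, `hinj`, `hsurj` — what the degree-`2` obstruction
map of a free presentation and the idèle readout (R3)/(R4) supply), for a family `inv` perfect at the
finite places and representable at the infinite ones (`harch`).  Then `Ш²_S(K, M)` is finite and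
`(c, y) ↦ e(c)(y)` is a PERFECT pairing `Ш²_S(K, M) × Ш¹_S(K, M^D) → ℤ/n` (both adjoints bijective):
`Σ`-local sums vanish on `Ш¹_S` (additivity), a pairing-trivial `c` has a readout killing `Ш¹_S`, hence
a local sum (§1), hence `c = 0` (injectivity); characters of `Ш¹_S` extend and are read (surjectivity);
counting. [cite: MilneADT2006, I Thm. 4.10 (a) (proof, p. 58) and I §0 Prop. 0.19]
[cite: Harari2020, Thm. 17.13 (b)] -/
theorem shaRestricted_tateDual_of_readout (ρ : DiscreteGaloisModule K M) (hM : ∀ m : M, n • m = 0)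
    (S : Set (HeightOneSpectrum (𝓞 K))) (Sig : Finset (Place K))
    (hSig₁ : ∀ w : InfinitePlace K, (Sum.inl w : Place K) ∈ Sig)
    (hSig₂ : ∀ v : HeightOneSpectrum (𝓞 K), (Sum.inr v : Place K) ∈ Sig ↔ v ∈ S)
    {inv : LocalInvariants K n} (hperf : inv.IsPerfect)
    (harch : ∀ (w : InfinitePlace K) (Φ : galoisCohomology ((ρ.tateDual n).toLocal (Sum.inl w)) 1 →+ ZMod n),
      ∃ t : galoisCohomology (ρ.toLocal (Sum.inl w)) 1,
        ∀ x, Φ x = localTatePairingZMod ρ n (Sum.inl w) (inv (Sum.inl w)) t x)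
    [Finite ↥(shaRestricted (ρ.tateDual n) S 1)]
    (e : ↥(shaRestricted ρ S 2) → (restrictedCohomology (ρ.tateDual n) S 1 →+ ZMod n))
    (hadd : ∀ c c' : ↥(shaRestricted ρ S 2), ∃ t : Π v : Place K, galoisCohomology (ρ.toLocal v) 1,
      ∀ y : restrictedCohomology (ρ.tateDual n) S 1,
        (e (c + c') - e c - e c') y = ∑ v ∈ Sig, localTatePairingZMod ρ n v (inv v) (t v)
          (restrictedLocalization (ρ.tateDual n) S v 1 y))
    (hinj : ∀ c : ↥(shaRestricted ρ S 2), (∃ t : Π v : Place K, galoisCohomology (ρ.toLocal v) 1,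
      ∀ y : restrictedCohomology (ρ.tateDual n) S 1,
        e c y = ∑ v ∈ Sig, localTatePairingZMod ρ n v (inv v) (t v)
          (restrictedLocalization (ρ.tateDual n) S v 1 y)) → c = 0)
    (hsurj : ∀ φ : restrictedCohomology (ρ.tateDual n) S 1 →+ ZMod n, ∃ (c : ↥(shaRestricted ρ S 2))
      (t : Π v : Place K, galoisCohomology (ρ.toLocal v) 1),
      ∀ y : restrictedCohomology (ρ.tateDual n) S 1,
        (φ - e c) y = ∑ v ∈ Sig, localTatePairingZMod ρ n v (inv v) (t v)
          (restrictedLocalization (ρ.tateDual n) S v 1 y)) :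
    Finite ↥(shaRestricted ρ S 2) ∧
      ∃ b : ↥(shaRestricted ρ S 2) →+ ↥(shaRestricted (ρ.tateDual n) S 1) →+ ZMod n,
        (∀ (c : ↥(shaRestricted ρ S 2)) (y : ↥(shaRestricted (ρ.tateDual n) S 1)), b c y = e c y) ∧
          Bijective b ∧ Bijective b.flip := by
  classical
  -- local sums vanish on `Ш¹_S(K, M^D)`
  have hsha_loc : ∀ (y : ↥(shaRestricted (ρ.tateDual n) S 1)) (v : Place K), v ∈ Sig →
      restrictedLocalization (ρ.tateDual n) S v 1 (y : restrictedCohomology (ρ.tateDual n) S 1) = 0 := by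
    rintro y (w | v) hv
    · exact ((DiscreteGaloisModule.mem_shaRestricted_iff _ _ _ _).1 y.2).1 w
    · exact ((DiscreteGaloisModule.mem_shaRestricted_iff _ _ _ _).1 y.2).2 v ((hSig₂ v).1 hv)
  have hlocal0 : ∀ (t : Π v : Place K, galoisCohomology (ρ.toLocal v) 1)
      (y : ↥(shaRestricted (ρ.tateDual n) S 1)),
      ∑ v ∈ Sig, localTatePairingZMod ρ n v (inv v) (t v)
        (restrictedLocalization (ρ.tateDual n) S v 1 (y : restrictedCohomology (ρ.tateDual n) S 1)) = 0 :=
    fun t y => Finset.sum_eq_zero fun v hv => by rw [hsha_loc y v hv, map_zero]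
  have hH1N : ∀ y : restrictedCohomology (ρ.tateDual n) S 1, n • y = 0 :=
    fun y => nsmul_restrictedCohomology_tateDual_eq_zero ρ S n 1 y
  have hshaN : ∀ y : ↥(shaRestricted (ρ.tateDual n) S 1), n • y = 0 :=
    fun y => nsmul_shaRestricted_tateDual_eq_zero ρ S n 1 y
  -- the pairing `b(c, y) = e(c)(y)`
  have hR_add : ∀ c c' : ↥(shaRestricted ρ S 2),
      (e (c + c')).comp (shaRestricted (ρ.tateDual n) S 1).subtype =
        (e c).comp (shaRestricted (ρ.tateDual n) S 1).subtype +
          (e c').comp (shaRestricted (ρ.tateDual n) S 1).subtype := by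
    intro c c'
    obtain ⟨t, h⟩ := hadd c c'
    ext y
    have hy := h (y : restrictedCohomology (ρ.tateDual n) S 1)
    rw [hlocal0] at hy
    simp only [AddMonoidHom.sub_apply] at hy
    simp only [AddMonoidHom.comp_apply, AddSubgroup.coe_subtype, AddMonoidHom.add_apply]
    rw [sub_sub, sub_eq_zero] at hy
    rw [hy]
  let b : ↥(shaRestricted ρ S 2) →+ (↥(shaRestricted (ρ.tateDual n) S 1) →+ ZMod n) :=
    { toFun := fun c => (e c).comp (shaRestricted (ρ.tateDual n) S 1).subtype
      map_zero' := by
        have h := hR_add 0 0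
        rw [add_zero] at h
        exact left_eq_add.1 h
      map_add' := hR_add }
  have hb : ∀ (c : ↥(shaRestricted ρ S 2)) (y : ↥(shaRestricted (ρ.tateDual n) S 1)), b c y = e c y :=
    fun _ _ => rfl
  -- injective: a readout vanishing on `Ш¹_S` is a local sum (§1), hence `c = 0` by (inj)
  have hbinj : Injective b := by
    intro c c' hcc'
    rw [← sub_eq_zero]
    apply hinj
    have h0 : b (c - c') = 0 := by rw [map_sub, hcc', sub_self]
    have hφ : ∀ y ∈ shaRestricted (ρ.tateDual n) S 1, e (c - c') y = 0 := fun y hy => by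
      have := DFunLike.congr_fun h0 ⟨y, hy⟩
      rwa [hb] at this
    exact exists_family_sum_localTatePairing_eq_of_shaRestricted ρ hM S Sig hSig₁ hSig₂ hperf harch
      (e (c - c')) hφ
  -- surjective: extend a character of `Ш¹_S` to `H¹(G_S, M^D)` and read it
  have hbsurj : Surjective b := by
    intro χ
    obtain ⟨φ, hφ⟩ := exists_addMonoidHom_extend_of_nsmul_eq_zero' hH1N (shaRestricted (ρ.tateDual n) S 1) χ
    obtain ⟨c, t, h⟩ := hsurj φ
    refine ⟨c, ?_⟩
    ext y
    have hy := h (y : restrictedCohomology (ρ.tateDual n) S 1)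
    rw [hlocal0, AddMonoidHom.sub_apply, sub_eq_zero] at hy
    rw [hb, ← hy, hφ]
  -- `Ш²_S` is `n`-torsion (it embeds in `Hom(Ш¹_S, ℤ/n)`) and finite
  have hshaTwoN : ∀ c : ↥(shaRestricted ρ S 2), n • c = 0 := fun c => hbinj (by
    rw [map_nsmul, map_zero]
    ext y
    rw [AddMonoidHom.nsmul_apply, AddMonoidHom.zero_apply, nsmul_eq_mul, ZMod.natCast_self, zero_mul])
  haveI : Finite (↥(shaRestricted (ρ.tateDual n) S 1) →+ ZMod n) := finite_addMonoidHom_zmod _ n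
  haveI hfin : Finite ↥(shaRestricted ρ S 2) := Finite.of_injective b hbinj
  -- the right adjoint is injective: characters of `Ш¹_S` separate points and `b` is onto them
  have hbflip : Injective b.flip := by
    intro y y' hyy'
    by_contra hne
    obtain ⟨χ, hχ⟩ := exists_addMonoidHom_zmod_apply_ne_zero hshaN (sub_ne_zero.2 hne)
    obtain ⟨c, rfl⟩ := hbsurj χ
    apply hχ
    have := DFunLike.congr_fun hyy' c
    rw [AddMonoidHom.flip_apply, AddMonoidHom.flip_apply] at this
    rw [map_sub, this, sub_self]
  exact ⟨hfin, b, hb, AddMonoidHom.bijective_of_injective_of_injective_flip hshaTwoN hshaN b hbinj hbflip⟩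

end Perfect

end Literature.NumberTheory.GaloisCohomology

end
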